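import Summits.AtomisticToContinuum.FouriersLaw.Theses.VanishingNoiseTransfer
import Summits.AtomisticToContinuum.FouriersLaw.Theorems.FourierGreenKuboFourierFiniteResponseOfUnique

/-!
# `VanishingNoiseBound` from a LINEAR noise-locality modulus and sub-harmonic divergence (the Drude dichotomy)

`--supports stmt-AtomisticToContinuum-11976` file (crux `VanishingNoiseBound`, route `VanishingNoiseTransfer`; continuation lead
c4). It lands, as an importable theorem, the reduction of the crux-ideate round-1 card `drude-or-bounded-dichotomy` (ideator 3,
`Cruxes/VanishingNoiseBound/Ideas/drude-or-bounded-dichotomy.md`; the ideator's `Sketch.lean` lives only in the gate evidence store),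
in a slightly stronger ONE-RATE form:

* `eventually_abs_le_of_oneNoiseWitness` — pure sequences: if `|D⁰_N − D^ε_N| ≤ w |D⁰_N| |D^ε_N|` for all `N`, `D^ε_N → κ > 0` and
  `κ·w < 1`, then `|D⁰_N| ≤ 2/(κ⁻¹ − w)` eventually — ONE noise level at which the resistivity increment `w` is smaller than the noisy
  resistivity `1/κ` forces eventually bounded deterministic response (the route text's `OneNoiseWitness`, kernel-exact).
* `vanishingNoiseBound_of_linearNoiseLocality_of_subharmonic` — the dichotomy: the sibling crux `NoiseLocality` (stmt-11975) with a
  LINEAR modulus `w(ε) = C ε` (inline hypothesis, same normal form as the route item), the sibling crux `NoisyFourier` (stmt-11977, by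
  name) and SUB-HARMONIC divergence `ε·κ_ε(T) → 0` of the noisy conductivities (inline hypothesis: no flip-Drude weight) imply
  `VanishingNoiseBound`. Mechanism: `NoisyFourier` at one rate `ε₀ ≤ 1` with `ε₀ κ_{ε₀} ≤ 1/(2C')` (`C' = max C 1`) is a one-noise
  witness (`κ_{ε₀} · C'ε₀ ≤ 1/2 < 1`), so `|D⁰_N| ≤ B` eventually; then, exactly as in the landed edge
  `vanishingNoiseBound_of_boundedResponse_of_noiseLocality` (p122997), the linear modulus transfers the bound to every
  `ε ≤ min(1/((2B+2)C'), 1)`: `k ≤ 2B + 2`. Under a linear modulus the only way the crux can fail is the harmonic/Mazur rate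
  `κ_ε ≥ 1/(Cε)` (Disproof §4 `cruxAt_false_of_inv_lower_bound`); any `o(1/ε)` information excludes it.
* `helper_vanishingNoiseBoundOfSubharmonic` — the registered helper sub-goal (same statement).

Honest size: by `vanishingNoiseBound_iff_boundedResponse` (p122997) the two inline hypotheses together with `NoisyFourier` imply
`BondHeatUncertainty.BoundedResponse` (stmt-11071); the linear modulus is the sibling 11975 STRENGTHENED and `ε κ_ε → 0` is flip-Drude
completeness — both open. No `sorry`, no definitions, no named facts. Real analysis only.
-/

noncomputable section

open MeasureTheory Filter Topology
open Literature.MathematicalPhysics.KineticTheory.HeatConduction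

namespace Summit.AtomisticToContinuum.FouriersLaw.Theorems.VanishingNoiseBound

/-- **One-noise witness ⟹ eventually bounded deterministic response** (pure real sequences). If two response sequences
satisfy the division-free locality bound `|D⁰_N − D^ε_N| ≤ w |D⁰_N| |D^ε_N|` for all `N`, the noisy one converges to `κ > 0`, and
`κ · w < 1` (the increment `w` is smaller than the noisy resistivity `1/κ`), then eventually `D⁰_N ≠ 0`,
`|1/D^ε_N − 1/D⁰_N| ≤ w` and `|1/D⁰_N| ≥ (κ⁻¹ − w)/2`, i.e. `|D⁰_N| ≤ 2/(κ⁻¹ − w)`.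
[cite: BonettoLebowitzReyBellet2000, §6.3] -/
theorem eventually_abs_le_of_oneNoiseWitness {D0 Dε : ℕ → ℝ} {w κ : ℝ} (hκ : 0 < κ)
    (hw : κ * w < 1) (hloc : ∀ N : ℕ, |D0 N - Dε N| ≤ w * |D0 N| * |Dε N|)
    (hconv : Tendsto Dε atTop (𝓝 κ)) :
    ∀ᶠ N in atTop, |D0 N| ≤ 2 / (κ⁻¹ - w) := by
  have hwκ : w < κ⁻¹ := by
    rw [← one_div, lt_div_iff₀ hκ]
    linarith [mul_comm κ w]
  have hgap : 0 < κ⁻¹ - w := by linarith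
  set η : ℝ := (κ⁻¹ - w) / 2 with hη
  have hηpos : 0 < η := by positivity
  have hinv : Tendsto (fun N => (Dε N)⁻¹) atTop (𝓝 κ⁻¹) := hconv.inv₀ hκ.ne'
  have h1 : ∀ᶠ N in atTop, κ / 2 < Dε N := hconv.eventually_const_lt (half_lt_self hκ)
  have h2 : ∀ᶠ N in atTop, κ⁻¹ - η < (Dε N)⁻¹ := hinv.eventually_const_lt (by linarith)
  filter_upwards [h1, h2] with N hN1 hN2
  have hDε : 0 < Dε N := by linarith [half_pos hκ]
  have hl := hloc N
  have hD0 : D0 N ≠ 0 := by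
    intro h0
    rw [h0] at hl
    simp only [zero_sub, abs_neg, abs_zero, mul_zero, zero_mul] at hl
    exact absurd (abs_nonpos_iff.mp hl) hDε.ne'
  have hprod : 0 < |D0 N| * |Dε N| := mul_pos (abs_pos.2 hD0) (abs_pos.2 hDε.ne')
  have h3 : |(Dε N)⁻¹ - (D0 N)⁻¹| ≤ w := by
    have heq : (Dε N)⁻¹ - (D0 N)⁻¹ = (D0 N - Dε N) / (D0 N * Dε N) := by
      field_simp
    rw [heq, abs_div, abs_mul, div_le_iff₀ hprod]
    calc |D0 N - Dε N| ≤ w * |D0 N| * |Dε N| := hl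
      _ = w * (|D0 N| * |Dε N|) := by ring
  have h4 : η ≤ |(D0 N)⁻¹| := by
    have h5 : |(Dε N)⁻¹| - |(D0 N)⁻¹| ≤ |(Dε N)⁻¹ - (D0 N)⁻¹| := abs_sub_abs_le_abs_sub _ _
    have h6 : |(Dε N)⁻¹| = (Dε N)⁻¹ := abs_of_pos (inv_pos.2 hDε)
    linarith
  have h7 : |D0 N| = |(D0 N)⁻¹|⁻¹ := by rw [abs_inv, inv_inv]
  rw [h7]
  calc |(D0 N)⁻¹|⁻¹ ≤ η⁻¹ := inv_anti₀ hηpos h4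
    _ = 2 / (κ⁻¹ - w) := by rw [hη, inv_div]

/-- **The Drude dichotomy, landed.** For `pinnedChain ω₂ lam β γ` (all `> 0`): assume (i) `NoiseLocality` with a LINEAR modulus — for
every `T > 0` a constant `C` with `|D⁰_N − D^ε_N| ≤ C ε |D⁰_N| |D^ε_N|` for all `N`, all `ε ∈ (0,1]`, the unique deterministic and the
unique flip-noisy steady families and their responses at `T` (the sibling crux stmt-11975 in the sharpened form its plan (a) targets);
(ii) `NoisyFourier` (stmt-11977); (iii) sub-harmonic divergence — for every `T > 0` and `c > 0` there is `ε₁ > 0` such that for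
`ε ∈ (0, ε₁]` every limit `k = lim_N D^ε_N` of responses of the unique noisy family satisfies `ε k ≤ c` (`ε κ_ε(T) → 0`: no flip-Drude
weight). THEN `VanishingNoiseBound`: `K = 2B + 2`, `B = 2/(κ_{ε₀}(T)⁻¹ − C'ε₀)` from the one-noise witness at
`ε₀ = min(ε₁(1/(2C')), 1)`, `C' = max C 1`, `ε₁ = min(1/((2B+2)C'), 1)`. [cite: BernardinOlla2011, Prop 4] -/
theorem vanishingNoiseBound_of_linearNoiseLocality_of_subharmonic
    (hLNL : ∀ ω₂ lam β γ : ℝ, 0 < ω₂ → 0 < lam → 0 < β → 0 < γ → ∀ S : ℝ → (N : ℕ) → ℝ → ℝ → MeasureTheory.Measure (Literature.MathematicalPhysics.KineticTheory.HeatConduction.PhaseSpace N) → Prop, S = (fun (ε : ℝ) (N : ℕ) (T_L T_R : ℝ) (μ : MeasureTheory.Measure (Literature.MathematicalPhysics.KineticTheory.HeatConduction.PhaseSpace N)) => MeasureTheory.IsProbabilityMeasure μ ∧ (∀ f : Literature.MathematicalPhysics.KineticTheory.HeatConduction.PhaseSpace N → ℝ, ContDiff ℝ ((⊤ : ℕ∞)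 : WithTop ℕ∞) f → HasCompactSupport f → MeasureTheory.integral μ (fun x => (Literature.MathematicalPhysics.KineticTheory.HeatConduction.pinnedChain ω₂ lam β γ).generator N T_L T_R f x + ε * ∑ i : Fin N, (f (x.1, Function.update x.2 i (-x.2 i)) - f x)) = 0) ∧ ∀ i : Fin N, MeasureTheory.Integrable ((Literature.MathematicalPhysics.KineticTheory.HeatConduction.pinnedChain ω₂ lam β γ).bondCurrent N i) μ) → ∀ T : ℝ, 0 < T → ∃ C : ℝ, ∀ (N : ℕ) (ε : ℝ), 0 < ε → ε ≤ 1 → ∀ μ0 με : ℝ → ℝ → MeasureTheory.Measure (Literature.MathematicalPhysics.KineticTheory.HeatConduction.PhaseSpace N), (∀ T_L T_R : ℝ, 0 < T_L → 0 < T_R → (Literature.MathematicalPhysics.KineticTheory.HeatConduction.pinnedChain ω₂ lam β γ).IsSteadyState N T_L T_R (μ0 T_L T_R) ∧ ∀ ν : MeasureTheory.Measure (Literature.MathematicalPhysics.KineticTheory.HeatConduction.PhaseSpace N), (Literature.MathematicalPhysics.KineticTheory.HeatConduction.pinnedChain ω₂ lam β γ).IsSteadyState N T_L T_R ν → ν =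 μ0 T_L T_R) → (∀ T_L T_R : ℝ, 0 < T_L → 0 < T_R → S ε N T_L T_R (με T_L T_R) ∧ ∀ ν : MeasureTheory.Measure (Literature.MathematicalPhysics.KineticTheory.HeatConduction.PhaseSpace N), S ε N T_L T_R ν → ν = με T_L T_R) → ∀ D0 Dε : ℝ, Filter.Tendsto (fun δ : ℝ => (Literature.MathematicalPhysics.KineticTheory.HeatConduction.pinnedChain ω₂ lam β γ).totalCurrent (μ0 (T + δ / 2) (T - δ / 2)) / δ) (nhdsWithin 0 {(0 : ℝ)}ᶜ) (nhds D0) → Filter.Tendsto (fun δ : ℝ => (Literature.MathematicalPhysics.KineticTheory.HeatConduction.pinnedChain ω₂ lam β γ).totalCurrent (με (T + δ / 2) (T - δ / 2)) / δ) (nhdsWithin 0 {(0 : ℝ)}ᶜ) (nhds Dε) → |D0 - Dε| ≤ C * ε * |D0| * |Dε|)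
    (hNF : Theses.VanishingNoiseTransfer.NoisyFourier)
    (hSub : ∀ ω₂ lam β γ : ℝ, 0 < ω₂ → 0 < lam → 0 < β → 0 < γ → ∀ S : ℝ → (N : ℕ) → ℝ → ℝ → MeasureTheory.Measure (Literature.MathematicalPhysics.KineticTheory.HeatConduction.PhaseSpace N) → Prop, S = (fun (ε : ℝ) (N : ℕ) (T_L T_R : ℝ) (μ : MeasureTheory.Measure (Literature.MathematicalPhysics.KineticTheory.HeatConduction.PhaseSpace N)) => MeasureTheory.IsProbabilityMeasure μ ∧ (∀ f : Literature.MathematicalPhysics.KineticTheory.HeatConduction.PhaseSpace N → ℝ, ContDiff ℝ ((⊤ : ℕ∞) : WithTop ℕ∞) f → HasCompactSupport f → MeasureTheory.integral μ (fun x => (Literature.MathematicalPhysics.KineticTheory.HeatConduction.pinnedChain ω₂ lam β γ).generator N T_L T_R f x + ε * ∑ i : Fin N, (f (x.1, Function.update x.2 i (-x.2 i)) - f x)) = 0) ∧ ∀ i : Fin N, MeasureTheory.Integrable ((Literature.MathematicalPhysics.KineticTheory.HeatConduction.pinnedChain ω₂ lam β γ).bondCurrent N i) μ) → ∀ T : ℝ,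 0 < T → ∀ c : ℝ, 0 < c → ∃ ε₁ : ℝ, 0 < ε₁ ∧ ∀ ε : ℝ, 0 < ε → ε ≤ ε₁ → ∀ μ : (N : ℕ) → ℝ → ℝ → MeasureTheory.Measure (Literature.MathematicalPhysics.KineticTheory.HeatConduction.PhaseSpace N), (∀ (N : ℕ) (T_L T_R : ℝ), 0 < T_L → 0 < T_R → S ε N T_L T_R (μ N T_L T_R) ∧ ∀ ν : MeasureTheory.Measure (Literature.MathematicalPhysics.KineticTheory.HeatConduction.PhaseSpace N), S ε N T_L T_R ν → ν = μ N T_L T_R) → ∀ (D : ℕ → ℝ) (k : ℝ), (∀ N : ℕ, Filter.Tendsto (fun δ : ℝ => (Literature.MathematicalPhysics.KineticTheory.HeatConduction.pinnedChain ω₂ lam β γ).totalCurrent (μ N (T + δ / 2) (T - δ / 2)) / δ) (nhdsWithin 0 {(0 : ℝ)}ᶜ) (nhds (D N))) → Filter.Tendsto D Filter.atTop (nhds k) → ε * k ≤ c) :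
    Theses.VanishingNoiseTransfer.VanishingNoiseBound := by
  intro ω₂ lam β γ hω hl hβ hγ S hS T hT
  have huniq := Theses.VanishingNoiseTransfer.NessUnique_holds ω₂ lam β γ hω hl hβ hγ
  -- (0) the unique deterministic steady family (landed existence theorem + NessUnique), by choice, and its responses
  have hex : ∀ (N : ℕ) (T_L T_R : ℝ), 0 < T_L → 0 < T_R →
      ∃ μ : Measure (PhaseSpace N), (pinnedChain ω₂ lam β γ).IsSteadyState N T_L T_R μ :=
    fun N T_L T_R hL hR' => pinnedChain_exists_isSteadyState hω hl hβ hγ N hL hR'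
  classical
  let μ0 : (N : ℕ) → ℝ → ℝ → Measure (PhaseSpace N) := fun N T_L T_R =>
    if h : 0 < T_L ∧ 0 < T_R then Classical.choose (hex N T_L T_R h.1 h.2) else 0
  have hμ0 : ∀ (N : ℕ) (T_L T_R : ℝ), 0 < T_L → 0 < T_R →
      (pinnedChain ω₂ lam β γ).IsSteadyState N T_L T_R (μ0 N T_L T_R) := by
    intro N T_L T_R hL hR'
    simp only [μ0, dif_pos (And.intro hL hR')]
    exact Classical.choose_spec (hex N T_L T_R hL hR')
  have hD0ex := Theorems.FourierGreenKubo.finiteResponse_of_unique ω₂ lam β γ hω hl hβ hγ huniq μ0 hμ0 T hT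
  choose D0 hD0 using hD0ex
  -- (1) the linear modulus constant `C`, enlarged to `C' = max C 1 > 0`
  obtain ⟨C, hC⟩ := hLNL ω₂ lam β γ hω hl hβ hγ S hS T hT
  set C' : ℝ := max C 1 with hC'def
  have hC'pos : 0 < C' := lt_of_lt_of_le one_pos (le_max_right _ _)
  have hCC' : C ≤ C' := le_max_left _ _
  -- locality with `C'` in place of `C`
  have hC' : ∀ (N : ℕ) (ε : ℝ), 0 < ε → ε ≤ 1 → ∀ με : ℝ → ℝ → Measure (PhaseSpace N),
      (∀ T_L T_R : ℝ, 0 < T_L → 0 < T_R → S ε N T_L T_R (με T_L T_R) ∧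
        ∀ ν : Measure (PhaseSpace N), S ε N T_L T_R ν → ν = με T_L T_R) →
      ∀ Dε : ℝ, Tendsto (fun δ : ℝ =>
          (pinnedChain ω₂ lam β γ).totalCurrent (με (T + δ / 2) (T - δ / 2)) / δ) (𝓝[≠] 0) (𝓝 Dε) →
        |D0 N - Dε| ≤ C' * ε * |D0 N| * |Dε| := by
    intro N ε hε hε1 με hμε Dε hDε
    have h := hC N ε hε hε1 (μ0 N) με
      (fun T_L T_R hL hR' => ⟨hμ0 N T_L T_R hL hR',
        fun ν hν => huniq N T_L T_R hL hR' ν _ hν (hμ0 N T_L T_R hL hR')⟩)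
      hμε (D0 N) Dε (hD0 N) hDε
    have hmono : C * ε * |D0 N| * |Dε| ≤ C' * ε * |D0 N| * |Dε| := by
      have h0 : 0 ≤ ε * |D0 N| * |Dε| := by positivity
      nlinarith
    exact h.trans hmono
  -- (2) sub-harmonic divergence with `c := 1/(2C')`, and the witness rate `ε₀ := min ε₂ 1`
  obtain ⟨ε₂, hε₂, hsub⟩ := hSub ω₂ lam β γ hω hl hβ hγ S hS T hT (1 / (2 * C')) (by positivity)
  set ε₀ : ℝ := min ε₂ 1 with hε₀def
  have hε₀ : 0 < ε₀ := lt_min hε₂ one_pos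
  have hε₀1 : ε₀ ≤ 1 := min_le_right _ _
  have hε₀2 : ε₀ ≤ ε₂ := min_le_left _ _
  -- (3) NoisyFourier at `ε₀`: the unique noisy family (by choice), its responses `Dε → κ T > 0`
  obtain ⟨hexu, κ, hκpos, hconv⟩ := hNF ω₂ lam β γ hω hl hβ hγ S hS ε₀ hε₀
  let με : (N : ℕ) → ℝ → ℝ → Measure (PhaseSpace N) := fun N T_L T_R =>
    if h : 0 < T_L ∧ 0 < T_R then Classical.choose (hexu N T_L T_R h.1 h.2) else 0
  have hμε : ∀ (N : ℕ) (T_L T_R : ℝ), 0 < T_L → 0 < T_R →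
      S ε₀ N T_L T_R (με N T_L T_R) ∧ ∀ ν : Measure (PhaseSpace N), S ε₀ N T_L T_R ν → ν = με N T_L T_R := by
    intro N T_L T_R hL hR'
    have h := Classical.choose_spec (hexu N T_L T_R hL hR')
    simp only [με, dif_pos (And.intro hL hR')]
    exact h
  obtain ⟨Dε, hDε, hDεlim⟩ := hconv με (fun N T_L T_R hL hR' => (hμε N T_L T_R hL hR').1) T hT
  have hκ₀ : 0 < κ T := hκpos T hT
  have hεκ : ε₀ * κ T ≤ 1 / (2 * C') := hsub ε₀ hε₀ hε₀2 με hμε Dε (κ T) hDε hDεlim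
  -- (4) the one-noise witness at `ε₀`: `κ T · (C' ε₀) ≤ 1/2 < 1`, hence `|D0 N| ≤ B` eventually
  have hlocN : ∀ N : ℕ, |D0 N - Dε N| ≤ C' * ε₀ * |D0 N| * |Dε N| := fun N =>
    hC' N ε₀ hε₀ hε₀1 (με N) (fun T_L T_R hL hR' => hμε N T_L T_R hL hR') (Dε N) (hDε N)
  have hw : κ T * (C' * ε₀) < 1 := by
    have h1 : κ T * (C' * ε₀) = C' * (ε₀ * κ T) := by ring
    have h2 : C' * (ε₀ * κ T) ≤ C' * (1 / (2 * C')) := mul_le_mul_of_nonneg_left hεκ hC'pos.le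
    have h3 : C' * (1 / (2 * C')) = 1 / 2 := by field_simp
    linarith
  have hevB := eventually_abs_le_of_oneNoiseWitness hκ₀ hw hlocN hDεlim
  set B : ℝ := 2 / ((κ T)⁻¹ - C' * ε₀) with hBdef
  have hgap : 0 < (κ T)⁻¹ - C' * ε₀ := by
    have : C' * ε₀ < (κ T)⁻¹ := by
      rw [← one_div, lt_div_iff₀ hκ₀]
      linarith [mul_comm (κ T) (C' * ε₀)]
    linarith
  have hBpos : 0 < B := by positivity
  have hA : (0 : ℝ) < 2 * B + 2 := by positivity
  -- (5) the crux: `K := 2B + 2`, `ε₁ := min (1/((2B+2) C')) 1`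
  subst hS
  refine ⟨2 * B + 2, min (1 / ((2 * B + 2) * C')) 1, lt_min (by positivity) one_pos, ?_⟩
  intro ε hε hεle μ hμ D k hD hk
  have hε1 : ε ≤ 1 := hεle.trans (min_le_right _ _)
  have hCε : C' * ε ≤ 1 / (2 * B + 2) := by
    have h1 : ε ≤ 1 / ((2 * B + 2) * C') := hεle.trans (min_le_left _ _)
    calc C' * ε ≤ C' * (1 / ((2 * B + 2) * C')) := mul_le_mul_of_nonneg_left h1 hC'pos.le
      _ = 1 / (2 * B + 2) := by field_simp
  -- transfer at each length `N`
  have hN : ∀ N : ℕ, |D0 N - D N| ≤ C' * ε * |D0 N| * |D N| := fun N =>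
    hC' N ε hε hε1 (μ N) (fun T_L T_R hL hR' => hμ N T_L T_R hL hR') (D N) (hD N)
  -- hence `D_N(ε) ≤ 2B + 2` eventually in `N`
  have hev : ∀ᶠ N in atTop, D N ≤ 2 * B + 2 := by
    filter_upwards [hevB] with N hBN
    by_cases hDN : D N ≤ 0
    · linarith
    · have hDN : 0 < D N := not_le.mp hDN
      have h1 := hN N
      have h2 : D N - D0 N ≤ C' * ε * |D0 N| * |D N| := by
        have h3 : D N - D0 N ≤ |D0 N - D N| := by
          rw [abs_sub_comm]
          exact le_abs_self _
        exact h3.trans h1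
      rw [abs_of_pos hDN] at h2
      have h4 : C' * ε * |D0 N| * D N ≤ 1 / (2 * B + 2) * B * D N := by
        have h5 : C' * ε * |D0 N| ≤ 1 / (2 * B + 2) * B :=
          mul_le_mul hCε hBN (abs_nonneg _) (by positivity)
        exact mul_le_mul_of_nonneg_right h5 hDN.le
      have h6 : 1 / (2 * B + 2) * B ≤ 1 / 2 := by
        rw [div_mul_eq_mul_div, one_mul, div_le_iff₀ hA]
        linarith
      have h7 : 1 / (2 * B + 2) * B * D N ≤ 1 / 2 * D N := mul_le_mul_of_nonneg_right h6 hDN.le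
      have h8 : D0 N ≤ B := (le_abs_self _).trans hBN
      linarith
  exact le_of_tendsto hk hev

/-- Registered helper sub-goal `helper_vanishingNoiseBoundOfSubharmonic` of crux stmt-AtomisticToContinuum-11976 (continuation lead c4):
the Drude-dichotomy edge `LinearNoiseLocality → NoisyFourier → SubharmonicNoisyConductivity → VanishingNoiseBound`
(`vanishingNoiseBound_of_linearNoiseLocality_of_subharmonic`), hypotheses inline in the route's normal form. -/
theorem helper_vanishingNoiseBoundOfSubharmonic : (∀ ω₂ lam β γ : ℝ, 0 < ω₂ → 0 < lam → 0 < β → 0 < γ → ∀ S : ℝ → (N : ℕ) → ℝ → ℝ → MeasureTheory.Measure (Literature.MathematicalPhysics.KineticTheory.HeatConduction.PhaseSpace N) → Prop, S = (fun (ε : ℝ) (N : ℕ) (T_L T_R : ℝ) (μ : MeasureTheory.Measure (Literature.MathematicalPhysics.KineticTheory.HeatConduction.PhaseSpace N)) => MeasureTheory.IsProbabilityMeasure μ ∧ (∀ f : Literature.MathematicalPhysics.KineticTheory.HeatConduction.PhaseSpace N → ℝ, ContDiff ℝ ((⊤ : ℕ∞) : WithTop ℕ∞) f → HasCompactSupport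 f → MeasureTheory.integral μ (fun x => (Literature.MathematicalPhysics.KineticTheory.HeatConduction.pinnedChain ω₂ lam β γ).generator N T_L T_R f x + ε * ∑ i : Fin N, (f (x.1, Function.update x.2 i (-x.2 i)) - f x)) = 0) ∧ ∀ i : Fin N, MeasureTheory.Integrable ((Literature.MathematicalPhysics.KineticTheory.HeatConduction.pinnedChain ω₂ lam β γ).bondCurrent N i) μ) → ∀ T : ℝ, 0 < T → ∃ C : ℝ, ∀ (N : ℕ) (ε : ℝ), 0 < ε → ε ≤ 1 → ∀ μ0 με : ℝ → ℝ → MeasureTheory.Measure (Literature.MathematicalPhysics.KineticTheory.HeatConduction.PhaseSpace N), (∀ T_L T_R : ℝ, 0 < T_L → 0 < T_R → (Literature.MathematicalPhysics.KineticTheory.HeatConduction.pinnedChain ω₂ lam β γ).IsSteadyState N T_L T_R (μ0 T_L T_R) ∧ ∀ ν : MeasureTheory.Measure (Literature.MathematicalPhysics.KineticTheory.HeatConduction.PhaseSpace N), (Literature.MathematicalPhysics.KineticTheory.HeatConduction.pinnedChain ω₂ lam β γ).IsSteadyState N T_L T_R ν → ν = μ0 T_L T_R) → (∀ T_L T_R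 : ℝ, 0 < T_L → 0 < T_R → S ε N T_L T_R (με T_L T_R) ∧ ∀ ν : MeasureTheory.Measure (Literature.MathematicalPhysics.KineticTheory.HeatConduction.PhaseSpace N), S ε N T_L T_R ν → ν = με T_L T_R) → ∀ D0 Dε : ℝ, Filter.Tendsto (fun δ : ℝ => (Literature.MathematicalPhysics.KineticTheory.HeatConduction.pinnedChain ω₂ lam β γ).totalCurrent (μ0 (T + δ / 2) (T - δ / 2)) / δ) (nhdsWithin 0 {(0 : ℝ)}ᶜ) (nhds D0) → Filter.Tendsto (fun δ : ℝ => (Literature.MathematicalPhysics.KineticTheory.HeatConduction.pinnedChain ω₂ lam β γ).totalCurrent (με (T + δ / 2) (T - δ / 2)) / δ) (nhdsWithin 0 {(0 : ℝ)}ᶜ) (nhds Dε) → |D0 - Dε| ≤ C * ε * |D0| * |Dε|) → Theses.VanishingNoiseTransfer.NoisyFourier → (∀ ω₂ lam β γ : ℝ, 0 < ω₂ → 0 < lam → 0 < β → 0 < γ → ∀ S : ℝ → (N : ℕ) → ℝ → ℝ → MeasureTheory.Measure (Literature.MathematicalPhysics.KineticTheory.HeatConduction.PhaseSpace N) → Prop,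 S = (fun (ε : ℝ) (N : ℕ) (T_L T_R : ℝ) (μ : MeasureTheory.Measure (Literature.MathematicalPhysics.KineticTheory.HeatConduction.PhaseSpace N)) => MeasureTheory.IsProbabilityMeasure μ ∧ (∀ f : Literature.MathematicalPhysics.KineticTheory.HeatConduction.PhaseSpace N → ℝ, ContDiff ℝ ((⊤ : ℕ∞) : WithTop ℕ∞) f → HasCompactSupport f → MeasureTheory.integral μ (fun x => (Literature.MathematicalPhysics.KineticTheory.HeatConduction.pinnedChain ω₂ lam β γ).generator N T_L T_R f x + ε * ∑ i : Fin N, (f (x.1, Function.update x.2 i (-x.2 i)) - f x)) = 0) ∧ ∀ i : Fin N, MeasureTheory.Integrable ((Literature.MathematicalPhysics.KineticTheory.HeatConduction.pinnedChain ω₂ lam β γ).bondCurrent N i) μ) → ∀ T : ℝ, 0 < T → ∀ c : ℝ, 0 < c → ∃ ε₁ : ℝ, 0 < ε₁ ∧ ∀ ε : ℝ, 0 < ε → ε ≤ ε₁ → ∀ μ : (N : ℕ) → ℝ → ℝ → MeasureTheory.Measure (Literature.MathematicalPhysics.KineticTheory.HeatConduction.PhaseSpace N), (∀ (N : ℕ)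 (T_L T_R : ℝ), 0 < T_L → 0 < T_R → S ε N T_L T_R (μ N T_L T_R) ∧ ∀ ν : MeasureTheory.Measure (Literature.MathematicalPhysics.KineticTheory.HeatConduction.PhaseSpace N), S ε N T_L T_R ν → ν = μ N T_L T_R) → ∀ (D : ℕ → ℝ) (k : ℝ), (∀ N : ℕ, Filter.Tendsto (fun δ : ℝ => (Literature.MathematicalPhysics.KineticTheory.HeatConduction.pinnedChain ω₂ lam β γ).totalCurrent (μ N (T + δ / 2) (T - δ / 2)) / δ) (nhdsWithin 0 {(0 : ℝ)}ᶜ) (nhds (D N))) → Filter.Tendsto D Filter.atTop (nhds k) → ε * k ≤ c) → Theses.VanishingNoiseTransfer.VanishingNoiseBound :=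
  vanishingNoiseBound_of_linearNoiseLocality_of_subharmonic

end Summit.AtomisticToContinuum.FouriersLaw.Theorems.VanishingNoiseBound

end
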